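import Summits.Langlands.Langlands.Theorems.PhantomRMYoshidaResiduallyYoshidaLiftingRibetCongruence
import Summits.Langlands.Langlands.Theorems.PhantomRMYoshidaResiduallyYoshidaLiftingRibetDescent
import Summits.Langlands.Langlands.Theorems.PhantomRMYoshidaResiduallyYoshidaLiftingFiniteNormValues
import Mathlib.Order.WellFoundedSet
import HarnessLib

/-!
# Ribet's non-split lattice over `ℤ̄_p` — III. The iteration (improvement step; arbitrarily small defects)

Lead prover-line-stmt-Langlands-13639-c2-0 (line `sector-klingen-split`, crux `ResiduallyYoshidaLifting`,
stmt-Langlands-13639), toward the registered stub `stub_ribetNonsplitLattice` (census §7 R1(a)).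

Setting: `𝒪 = 𝒪(ℚ̄_p)` (NON-discrete valuation ring), a compact group `Γ`, `ρ : Γ → GL(m ⊕ n, 𝒪)` with
continuous entries and residually zero lower-left block.  For an integral `W : n → m` the DEFECT
`Φ_W(g) = B + A W - W D - W C W` (`defect`, file I) measures the failure of the graph of `W` to be stable.

* `defect_improve` (one step of Ribet's iteration): if `Φ_W = t · Φd` and `res Φd = Ā X̄ - X̄ D̄` is a residual
  COBOUNDARY, then `W - t X` has defect of norm `< ‖t‖` everywhere.
* `exists_small_defect`: if EVERY rescaled defect is a residual coboundary, then there are integral `W` with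
  defect of arbitrarily small norm.  This is where the non-discreteness of `𝒪` is overcome WITHOUT Krasner/Baire:
  by compactness `ρ(Γ)` has a finite `ε`-net modulo the ball ideal (file I); the iteration is run RATIONALLY over
  the finite extension `E = ℚ_p(entries of the net)` (residual coboundary solutions descend to the residue
  subfield of `E`, file II), and the maximal defect over the net strictly decreases inside the FINITE set of
  values of `‖·‖` on `E ∩ [ε, 1]` (`stub_finiteNormValues`), so it drops below `ε` after finitely many steps.

References: K. Ribet, Invent. Math. 34 (1976), Prop. 2.1; J. Bellaïche–G. Chenevier, Astérisque 324 (2009),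
§1.5 (discrete / noetherian case).  The argument for the non-discrete valuation ring is this lead's. [folklore]
-/

noncomputable section

open scoped MatrixGroups

open Matrix IsLocalRing

-- `Summit.Langlands.Langlands.…` (summit = sub-problem name, D-0017 layout) trips `dupNamespace` on every decl.
set_option linter.dupNamespace false
set_option autoImplicit false

namespace Summit.Langlands.Langlands.Cruxes.ResiduallyYoshidaLifting.SectorKlingenSplit.Ribet

open Summit.Langlands.Langlands.Cruxes.ResiduallyYoshidaLifting.EndoscopicCrossingEuler

section Improve

variable {p : ℕ} [Fact p.Prime]

/-- The defect of `W - t X`, expanded. [folklore] -/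
theorem defect_sub_smul {R : Type*} [CommRing R] {m n : Type*} [Fintype m] [Fintype n]
    (M : Matrix (m ⊕ n) (m ⊕ n) R) (W X : Matrix m n R) (t : R) :
    defect M (W - t • X) = defect M W - t • (M.toBlocks₁₁ * X - X * M.toBlocks₂₂) +
      t • (W * M.toBlocks₂₁ * X + X * M.toBlocks₂₁ * W) - (t * t) • (X * M.toBlocks₂₁ * X) := by
  simp only [defect, Matrix.mul_sub, Matrix.sub_mul, Matrix.mul_smul, Matrix.smul_mul, smul_sub, smul_add,
    mul_smul, Matrix.mul_assoc]
  abel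

/-- The residue of `t • N` is `res t • res N`. [folklore] -/
theorem map_residue_smul {m n : Type*} (t : Valued.integer (PadicAlgCl p))
    (N : Matrix m n (Valued.integer (PadicAlgCl p))) :
    (t • N).map (residue (Valued.integer (PadicAlgCl p))) =
      residue (Valued.integer (PadicAlgCl p)) t • N.map (residue (Valued.integer (PadicAlgCl p))) :=
  Matrix.map_smulₛₗ _ _ _ (fun a => by simp [smul_eq_mul]) _

/-- **Improvement step.**  Let `M` be an integral block matrix with residually zero lower-left block, `W`
integral, `defect M W = t • Φd` with `t ≠ 0`, and suppose the residue of `Φd` is a coboundary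
`Ā · X̄ - X̄ · D̄` for an integral `X`.  Then the defect of `W - t • X` has norm `< ‖t‖` entrywise. [folklore] -/
theorem defect_improve {m n : Type*} [Fintype m] [Fintype n]
    (M : Matrix (m ⊕ n) (m ⊕ n) (Valued.integer (PadicAlgCl p)))
    (hC : M.toBlocks₂₁.map (residue (Valued.integer (PadicAlgCl p))) = 0)
    {W X Φd : Matrix m n (Valued.integer (PadicAlgCl p))} {t : Valued.integer (PadicAlgCl p)} (ht : t ≠ 0)
    (hΦ : defect M W = t • Φd)
    (hX : Φd.map (residue (Valued.integer (PadicAlgCl p))) =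
      M.toBlocks₁₁.map (residue (Valued.integer (PadicAlgCl p))) * X.map (residue (Valued.integer (PadicAlgCl p))) -
        X.map (residue (Valued.integer (PadicAlgCl p))) * M.toBlocks₂₂.map (residue (Valued.integer (PadicAlgCl p)))) :
    ∀ i j, ‖((defect M (W - t • X) i j : Valued.integer (PadicAlgCl p)) : PadicAlgCl p)‖ <
      ‖(t : PadicAlgCl p)‖ := by
  set Y : Matrix m n (Valued.integer (PadicAlgCl p)) :=
    Φd - (M.toBlocks₁₁ * X - X * M.toBlocks₂₂) + (W * M.toBlocks₂₁ * X + X * M.toBlocks₂₁ * W) -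
      t • (X * M.toBlocks₂₁ * X) with hY
  have hdef : defect M (W - t • X) = t • Y := by
    rw [defect_sub_smul, hΦ, hY]
    simp only [smul_sub, smul_add, mul_smul]
  have hYres : Y.map (residue (Valued.integer (PadicAlgCl p))) = 0 := by
    rw [hY]
    rw [Matrix.map_sub _ (map_sub _), Matrix.map_add _ (map_add _), Matrix.map_sub _ (map_sub _),
      Matrix.map_sub _ (map_sub _), Matrix.map_add _ (map_add _), map_residue_smul, Matrix.map_mul,
      Matrix.map_mul, Matrix.map_mul, Matrix.map_mul, Matrix.map_mul, Matrix.map_mul, Matrix.map_mul,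
      Matrix.map_mul, hC, hX]
    simp
  intro i j
  have hres : residue (Valued.integer (PadicAlgCl p)) (Y i j) = 0 := by
    simpa using congrFun (congrFun hYres i) j
  have h := norm_mul_lt_of_residue_eq_zero ht hres
  rw [hdef, Matrix.smul_apply, smul_eq_mul]
  exact h

end Improve

section Iterate

variable {p : ℕ} [Fact p.Prime] {E : IntermediateField ℚ_[p] (PadicAlgCl p)}

/-- Defects of rational data are rational. [folklore] -/
theorem IsRat.defect {m n : Type*} [Fintype m] [Fintype n]
    {M : Matrix (m ⊕ n) (m ⊕ n) (Valued.integer (PadicAlgCl p))} {W : Matrix m n (Valued.integer (PadicAlgCl p))}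
    (hM : IsRat E M) (hW : IsRat E W) : IsRat E (defect M W) := by
  obtain ⟨h11, h12, h21, h22⟩ := hM.toBlocks
  exact ((h12.add (h11.mul hW)).sub (hW.mul h22)).sub ((hW.mul h21).mul hW)

/-- Ultrametric comparison: `‖x‖ ≤ max ‖y‖ ‖x - y‖`. [folklore] -/
theorem norm_le_max_norm_sub (x y : PadicAlgCl p) : ‖x‖ ≤ max ‖y‖ ‖x - y‖ := by
  have h := IsUltrametricDist.norm_add_le_max y (x - y)
  rwa [add_sub_cancel] at h

/-- **Arbitrarily small defects.**  Let `Γ` be compact, `ρ : Γ → GL(m ⊕ n, 𝒪)` a homomorphism with continuous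
entries whose lower-left block is residually zero, and suppose that EVERY rescaled defect is a residual
coboundary: whenever `defect (ρ g) W = t • Φd g` for all `g` (`W` integral, `t ≠ 0`), there is an integral `X`
with `res (Φd g) = Ā(g) X̄ - X̄ D̄(g)` for all `g`.  Then for every `ε > 0` some integral `W` has
`‖defect (ρ g) W‖ < ε` for all `g`.  (Run the improvement step `E`-rationally for the finite extension `E` of
`ℚ_p` generated by an `ε`-net of `ρ(Γ)`; the maximal defect over the net strictly decreases inside the finite
set of values of `‖·‖` on `E ∩ [ε, 1]`.) [folklore] -/
theorem exists_small_defect {Γ : Type*} [Group Γ] [TopologicalSpace Γ] [CompactSpace Γ] {m n : Type*}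
    [Fintype m] [Fintype n] [DecidableEq m] [DecidableEq n] [Nonempty m] [Nonempty n]
    (ρ : Γ →* GL (m ⊕ n) (Valued.integer (PadicAlgCl p)))
    (hρ : ∀ i j, Continuous fun g => (((ρ g : GL (m ⊕ n) (Valued.integer (PadicAlgCl p))) :
      Matrix (m ⊕ n) (m ⊕ n) (Valued.integer (PadicAlgCl p))) i j : PadicAlgCl p))
    (hC : ∀ g, ((ρ g : GL (m ⊕ n) (Valued.integer (PadicAlgCl p))) :
      Matrix (m ⊕ n) (m ⊕ n) (Valued.integer (PadicAlgCl p))).toBlocks₂₁.map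
        (residue (Valued.integer (PadicAlgCl p))) = 0)
    (H : ∀ (W : Matrix m n (Valued.integer (PadicAlgCl p))) (t : Valued.integer (PadicAlgCl p))
      (Φd : Γ → Matrix m n (Valued.integer (PadicAlgCl p))), t ≠ 0 →
      (∀ g, defect ((ρ g : GL (m ⊕ n) (Valued.integer (PadicAlgCl p))) :
        Matrix (m ⊕ n) (m ⊕ n) (Valued.integer (PadicAlgCl p))) W = t • Φd g) →
      ∃ X : Matrix m n (Valued.integer (PadicAlgCl p)), ∀ g,
        (Φd g).map (residue (Valued.integer (PadicAlgCl p))) =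
          ((ρ g : GL (m ⊕ n) (Valued.integer (PadicAlgCl p))) :
            Matrix (m ⊕ n) (m ⊕ n) (Valued.integer (PadicAlgCl p))).toBlocks₁₁.map
              (residue (Valued.integer (PadicAlgCl p))) * X.map (residue (Valued.integer (PadicAlgCl p))) -
          X.map (residue (Valued.integer (PadicAlgCl p))) *
            ((ρ g : GL (m ⊕ n) (Valued.integer (PadicAlgCl p))) :
              Matrix (m ⊕ n) (m ⊕ n) (Valued.integer (PadicAlgCl p))).toBlocks₂₂.map
                (residue (Valued.integer (PadicAlgCl p))))
    {ε : ℝ} (hε : 0 < ε) :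
    ∃ W : Matrix m n (Valued.integer (PadicAlgCl p)), ∀ g i j,
      ‖((defect ((ρ g : GL (m ⊕ n) (Valued.integer (PadicAlgCl p))) :
        Matrix (m ⊕ n) (m ⊕ n) (Valued.integer (PadicAlgCl p))) W i j : Valued.integer (PadicAlgCl p)) :
          PadicAlgCl p)‖ < ε := by
  classical
  -- notation: the matrix of `ρ g`
  set R : Γ → Matrix (m ⊕ n) (m ⊕ n) (Valued.integer (PadicAlgCl p)) :=
    fun g => ((ρ g : GL (m ⊕ n) (Valued.integer (PadicAlgCl p))) :
      Matrix (m ⊕ n) (m ⊕ n) (Valued.integer (PadicAlgCl p))) with hR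
  -- wlog `ε ≤ 1`
  obtain ⟨ε₁, hε₁, hε₁1, hε₁ε⟩ : ∃ ε₁ : ℝ, 0 < ε₁ ∧ ε₁ ≤ 1 ∧ ε₁ ≤ ε :=
    ⟨min ε 1, lt_min hε one_pos, min_le_right _ _, min_le_left _ _⟩
  suffices h : ∃ W : Matrix m n (Valued.integer (PadicAlgCl p)), ∀ g i j,
      ‖((defect (R g) W i j : Valued.integer (PadicAlgCl p)) : PadicAlgCl p)‖ < ε₁ by
    obtain ⟨W, hW⟩ := h
    exact ⟨W, fun g i j => (hW g i j).trans_le hε₁ε⟩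
  -- (a) a finite net modulo `ballIdeal ε₁`
  obtain ⟨F, hF⟩ := exists_finset_net ρ hρ hε₁
  have hFne : F.Nonempty := by
    obtain ⟨γ, hγ, -⟩ := hF 1
    exact ⟨γ, hγ⟩
  -- (b) the field `E` generated by the entries of the net
  let S : Set (PadicAlgCl p) := Set.range fun q : F × (m ⊕ n) × (m ⊕ n) =>
    ((R q.1 q.2.1 q.2.2 : Valued.integer (PadicAlgCl p)) : PadicAlgCl p)
  have hS : S.Finite := Set.finite_range _
  let E : IntermediateField ℚ_[p] (PadicAlgCl p) := IntermediateField.adjoin ℚ_[p] S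
  have hρE : ∀ γ ∈ F, IsRat E (R γ) := fun γ hγ i j =>
    IntermediateField.subset_adjoin _ _ ⟨(⟨γ, hγ⟩, i, j), rfl⟩
  -- (c) the finite set of values of `‖·‖` on `E ∩ [ε₁, 1]`, well-founded under `<`
  let V : Set ℝ := {x | ε₁ ≤ x ∧ x ≤ 1 ∧ ∃ y ∈ IntermediateField.adjoin ℚ_[p] S, ‖(y : PadicAlgCl p)‖ = x}
  have hV : V.Finite := stub_finiteNormValues p S hS ε₁ hε₁
  have hwf : V.WellFoundedOn (· < ·) := hV.wellFoundedOn
  -- the index set of the maxima and the defect-value function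
  let T : Finset (Γ × (m × n)) := F ×ˢ (Finset.univ : Finset (m × n))
  have hTne : T.Nonempty := hFne.product Finset.univ_nonempty
  have hmemT : ∀ γ ∈ F, ∀ (i : m) (j : n), (γ, (i, j)) ∈ T := fun γ hγ i j =>
    Finset.mem_product.2 ⟨hγ, Finset.mem_univ _⟩
  let f : Matrix m n (Valued.integer (PadicAlgCl p)) → Γ × (m × n) → ℝ := fun W q =>
    ‖((defect (R q.1) W q.2.1 q.2.2 : Valued.integer (PadicAlgCl p)) : PadicAlgCl p)‖
  -- congruences propagate from `ρ` to defects
  have hcong : ∀ (W : Matrix m n (Valued.integer (PadicAlgCl p))) (g : Γ), ∃ γ ∈ F,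
      (defect (R g) W).map (Ideal.Quotient.mk (ballIdeal ε₁ hε₁)) =
        (defect (R γ) W).map (Ideal.Quotient.mk (ballIdeal ε₁ hε₁)) ∧
      (R g).map (Ideal.Quotient.mk (ballIdeal ε₁ hε₁)) = (R γ).map (Ideal.Quotient.mk (ballIdeal ε₁ hε₁)) := by
    intro W g
    obtain ⟨γ, hγF, hγ⟩ := hF g
    exact ⟨γ, hγF, by rw [defect_map, defect_map, hγ], hγ⟩
  -- a uniform bound on the net is a uniform bound everywhere, up to `ε₁`
  have hglob : ∀ (W : Matrix m n (Valued.integer (PadicAlgCl p))) (v : ℝ), (∀ q ∈ T, f W q ≤ v) →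
      ∀ g i j, ‖((defect (R g) W i j : Valued.integer (PadicAlgCl p)) : PadicAlgCl p)‖ ≤ max v ε₁ ∧
        (v < ε₁ → ‖((defect (R g) W i j : Valued.integer (PadicAlgCl p)) : PadicAlgCl p)‖ < ε₁) := by
    intro W v hv g i j
    obtain ⟨γ, hγF, hdγ, -⟩ := hcong W g
    have h1 := norm_sub_lt_of_mk_eq hε₁ (congrFun (congrFun hdγ i) j)
    have h2 : ‖((defect (R γ) W i j : Valued.integer (PadicAlgCl p)) : PadicAlgCl p)‖ ≤ v :=
      hv (γ, (i, j)) (hmemT γ hγF i j)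
    have h3 := norm_le_max_norm_sub
      ((defect (R g) W i j : Valued.integer (PadicAlgCl p)) : PadicAlgCl p)
      ((defect (R γ) W i j : Valued.integer (PadicAlgCl p)) : PadicAlgCl p)
    exact ⟨h3.trans (max_le_max h2 h1.le), fun hvε => h3.trans_lt (max_lt (h2.trans_lt hvε) h1)⟩
  -- MAIN CLAIM, by well-founded induction on the maximal defect value over the net
  have main : ∀ v ∈ V, ∀ W : Matrix m n (Valued.integer (PadicAlgCl p)), IsRat E W →
      (∀ q ∈ T, f W q ≤ v) → (∃ q ∈ T, f W q = v) →
      ∃ W' : Matrix m n (Valued.integer (PadicAlgCl p)), ∀ g i j,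
        ‖((defect (R g) W' i j : Valued.integer (PadicAlgCl p)) : PadicAlgCl p)‖ < ε₁ := by
    intro v hv
    refine hwf.induction hv (P := fun v => ∀ W : Matrix m n (Valued.integer (PadicAlgCl p)), IsRat E W →
      (∀ q ∈ T, f W q ≤ v) → (∃ q ∈ T, f W q = v) →
      ∃ W' : Matrix m n (Valued.integer (PadicAlgCl p)), ∀ g i j,
        ‖((defect (R g) W' i j : Valued.integer (PadicAlgCl p)) : PadicAlgCl p)‖ < ε₁) ?_
    intro v hv ih W hW hle hq₀
    obtain ⟨q₀, hq₀T, hq₀⟩ := hq₀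
    have hq₀F : q₀.1 ∈ F := (Finset.mem_product.1 hq₀T).1
    -- the pivot `t`
    set t : Valued.integer (PadicAlgCl p) := defect (R q₀.1) W q₀.2.1 q₀.2.2 with ht
    have htv : ‖(t : PadicAlgCl p)‖ = v := hq₀
    have hεv : ε₁ ≤ v := hv.1
    have hvpos : 0 < v := hε₁.trans_le hεv
    have ht0 : t ≠ 0 := by
      intro h0
      rw [h0] at htv
      simp only [ZeroMemClass.coe_zero, norm_zero] at htv
      exact hvpos.ne htv
    have htE : (t : PadicAlgCl p) ∈ E := (hρE _ hq₀F).defect hW _ _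
    -- the global bound `‖defect (ρ g) W‖ ≤ ‖t‖`
    have hbound : ∀ g i j, ‖((defect (R g) W i j : Valued.integer (PadicAlgCl p)) : PadicAlgCl p)‖ ≤
        ‖(t : PadicAlgCl p)‖ := by
      intro g i j
      rw [htv]
      have h := (hglob W v hle g i j).1
      rwa [max_eq_left hεv] at h
    -- the rescaled defects `Φd`
    have hΦex : ∀ g, ∃ N : Matrix m n (Valued.integer (PadicAlgCl p)), defect (R g) W = t • N := fun g =>
      exists_eq_smul_of_norm_le ht0 (hbound g)
    choose Φd hΦd using hΦex
    -- hypothesis (H): a residual coboundary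
    obtain ⟨X, hX⟩ := H W t Φd ht0 hΦd
    -- residues are `k₁`-rational, `k₁` the residue subfield of `E`
    have hrescong : ∀ g, ∃ γ ∈ F,
        (R g).map (residue (Valued.integer (PadicAlgCl p))) = (R γ).map (residue (Valued.integer (PadicAlgCl p))) ∧
        (Φd g).map (residue (Valued.integer (PadicAlgCl p))) =
          (Φd γ).map (residue (Valued.integer (PadicAlgCl p))) := by
      intro g
      obtain ⟨γ, hγF, hdγ, hργ⟩ := hcong W g
      refine ⟨γ, hγF, map_residue_eq_of_map_mk_eq hε₁ hε₁1 hργ, ?_⟩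
      ext i j
      have h1 := norm_sub_lt_of_mk_eq hε₁ (congrFun (congrFun hdγ i) j)
      rw [hΦd g, hΦd γ, Matrix.smul_apply, Matrix.smul_apply, smul_eq_mul, smul_eq_mul] at h1
      push_cast at h1
      rw [← mul_sub, norm_mul, htv] at h1
      have h2 : ‖((Φd g i j : Valued.integer (PadicAlgCl p)) : PadicAlgCl p) - (Φd γ i j : Valued.integer (PadicAlgCl p))‖ < 1 := by
        by_contra hge
        push Not at hge
        have : v * 1 ≤ v * ‖((Φd g i j : Valued.integer (PadicAlgCl p)) : PadicAlgCl p) -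
            (Φd γ i j : Valued.integer (PadicAlgCl p))‖ := mul_le_mul_of_nonneg_left hge hvpos.le
        linarith
      rw [Matrix.map_apply, Matrix.map_apply, ← sub_eq_zero, ← map_sub, residue_eq_zero_iff_norm_lt_one]
      push_cast
      exact h2
    have hk₁ : (∀ g a c, ((R g).toBlocks₁₁.map (residue (Valued.integer (PadicAlgCl p)))) a c ∈ residueSubfield E) ∧
        (∀ g a c, ((R g).toBlocks₂₂.map (residue (Valued.integer (PadicAlgCl p)))) a c ∈ residueSubfield E) ∧
        (∀ g a c, ((Φd g).map (residue (Valued.integer (PadicAlgCl p)))) a c ∈ residueSubfield E) := by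
      refine ⟨fun g a c => ?_, fun g a c => ?_, fun g a c => ?_⟩
      · obtain ⟨γ, hγF, hργ, -⟩ := hrescong g
        rw [← toBlocks₁₁_map, hργ, toBlocks₁₁_map, Matrix.map_apply]
        exact (hρE γ hγF).toBlocks.1.residue_mem a c
      · obtain ⟨γ, hγF, hργ, -⟩ := hrescong g
        rw [← toBlocks₂₂_map, hργ, toBlocks₂₂_map, Matrix.map_apply]
        exact (hρE γ hγF).toBlocks.2.2.2.residue_mem a c
      · obtain ⟨γ, hγF, -, hΦγ⟩ := hrescong g
        rw [hΦγ, Matrix.map_apply]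
        have hΦdE : IsRat E (Φd γ) :=
          IsRat.of_smul htE ht0 (by rw [← hΦd γ]; exact (hρE γ hγF).defect hW)
        exact hΦdE.residue_mem a c
    -- descent of the coboundary solution to `k₁`, and a rational integral lift
    obtain ⟨X₁, hX₁k, hX₁⟩ := coboundary_descent (residueSubfield E)
      (fun g => (R g).toBlocks₁₁.map (residue (Valued.integer (PadicAlgCl p))))
      (fun g => (R g).toBlocks₂₂.map (residue (Valued.integer (PadicAlgCl p))))
      (fun g => (Φd g).map (residue (Valued.integer (PadicAlgCl p)))) hk₁.1 hk₁.2.1 hk₁.2.2 hX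
    obtain ⟨Xr, hXrE, hXr⟩ := exists_isRat_lift X₁ hX₁k
    -- the improved `W₁`
    set W₁ : Matrix m n (Valued.integer (PadicAlgCl p)) := W - t • Xr with hW₁
    have hW₁E : IsRat E W₁ := hW.sub (IsRat.smul htE hXrE)
    have hlt : ∀ g i j, ‖((defect (R g) W₁ i j : Valued.integer (PadicAlgCl p)) : PadicAlgCl p)‖ <
        ‖(t : PadicAlgCl p)‖ := fun g =>
      defect_improve (R g) (hC g) ht0 (hΦd g) (by rw [hXr]; exact hX₁ g)
    -- its maximal defect value on the net
    obtain ⟨q₁, hq₁T, hq₁max⟩ := T.exists_max_image (f W₁) hTne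
    have hv₁v : f W₁ q₁ < v := by
      rw [← htv]
      exact hlt _ _ _
    by_cases hv₁ε : f W₁ q₁ < ε₁
    · exact ⟨W₁, fun g i j => (hglob W₁ _ hq₁max g i j).2 hv₁ε⟩
    · push Not at hv₁ε
      have hq₁F : q₁.1 ∈ F := (Finset.mem_product.1 hq₁T).1
      have hv₁V : f W₁ q₁ ∈ V :=
        ⟨hv₁ε, (mem_integer_iff_norm_le_one _).1 (SetLike.coe_mem _),
          ⟨_, (hρE _ hq₁F).defect hW₁E _ _, rfl⟩⟩
      exact ih _ hv₁V hv₁v W₁ hW₁E hq₁max ⟨q₁, hq₁T, rfl⟩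
  -- START of the iteration at `W = 0`
  obtain ⟨q₀, hq₀T, hq₀max⟩ := T.exists_max_image (f 0) hTne
  by_cases h0 : f 0 q₀ < ε₁
  · exact ⟨0, fun g i j => (hglob 0 _ hq₀max g i j).2 h0⟩
  · push Not at h0
    have hq₀F : q₀.1 ∈ F := (Finset.mem_product.1 hq₀T).1
    have hv₀V : f 0 q₀ ∈ V :=
      ⟨h0, (mem_integer_iff_norm_le_one _).1 (SetLike.coe_mem _),
        ⟨_, (hρE _ hq₀F).defect isRat_zero _ _, rfl⟩⟩
    exact main _ hv₀V 0 isRat_zero hq₀max ⟨q₀, hq₀T, rfl⟩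

end Iterate

/-- **Registered statement `stub_ribetSmallDefect`** (wrapper of `exists_small_defect` with explicit binders and
the defect spelled out, the form recorded on the crux item). [folklore] -/
theorem stub_ribetSmallDefect :
    ∀ (p : ℕ) [Fact p.Prime] (Γ : Type) [Group Γ] [TopologicalSpace Γ] [CompactSpace Γ] (m n : Type)
      [Fintype m] [Fintype n] [DecidableEq m] [DecidableEq n] [Nonempty m] [Nonempty n]
      (ρ : Γ →* GL (m ⊕ n) (Valued.integer (PadicAlgCl p))),
      (∀ i j, Continuous fun g => (((ρ g : GL (m ⊕ n) (Valued.integer (PadicAlgCl p))) :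
        Matrix (m ⊕ n) (m ⊕ n) (Valued.integer (PadicAlgCl p))) i j : PadicAlgCl p)) →
      (∀ g, ((ρ g : GL (m ⊕ n) (Valued.integer (PadicAlgCl p))) :
        Matrix (m ⊕ n) (m ⊕ n) (Valued.integer (PadicAlgCl p))).toBlocks₂₁.map
          (IsLocalRing.residue (Valued.integer (PadicAlgCl p))) = 0) →
      (∀ (W : Matrix m n (Valued.integer (PadicAlgCl p))) (t : Valued.integer (PadicAlgCl p))
        (Φd : Γ → Matrix m n (Valued.integer (PadicAlgCl p))), t ≠ 0 →
        (∀ g, defect ((ρ g : GL (m ⊕ n) (Valued.integer (PadicAlgCl p))) :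
          Matrix (m ⊕ n) (m ⊕ n) (Valued.integer (PadicAlgCl p))) W = t • Φd g) →
        ∃ X : Matrix m n (Valued.integer (PadicAlgCl p)), ∀ g,
          (Φd g).map (IsLocalRing.residue (Valued.integer (PadicAlgCl p))) =
            ((ρ g : GL (m ⊕ n) (Valued.integer (PadicAlgCl p))) :
              Matrix (m ⊕ n) (m ⊕ n) (Valued.integer (PadicAlgCl p))).toBlocks₁₁.map
                (IsLocalRing.residue (Valued.integer (PadicAlgCl p))) *
              X.map (IsLocalRing.residue (Valued.integer (PadicAlgCl p))) -
            X.map (IsLocalRing.residue (Valued.integer (PadicAlgCl p))) *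
              ((ρ g : GL (m ⊕ n) (Valued.integer (PadicAlgCl p))) :
                Matrix (m ⊕ n) (m ⊕ n) (Valued.integer (PadicAlgCl p))).toBlocks₂₂.map
                  (IsLocalRing.residue (Valued.integer (PadicAlgCl p)))) →
      ∀ ε : ℝ, 0 < ε → ∃ W : Matrix m n (Valued.integer (PadicAlgCl p)), ∀ g i j,
        ‖((defect ((ρ g : GL (m ⊕ n) (Valued.integer (PadicAlgCl p))) :
          Matrix (m ⊕ n) (m ⊕ n) (Valued.integer (PadicAlgCl p))) W i j : Valued.integer (PadicAlgCl p)) :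
            PadicAlgCl p)‖ < ε := by
  intro p _ Γ _ _ _ m n _ _ _ _ _ _ ρ hρ hC H ε hε
  exact exists_small_defect ρ hρ hC H hε

end Summit.Langlands.Langlands.Cruxes.ResiduallyYoshidaLifting.SectorKlingenSplit.Ribet

end
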